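import Mathlib
import HarnessLib
import Literature.Computability.AlgebraicComplexity.SymmetricArithCircuit
import Literature.Computability.AlgebraicComplexity.SymmetricThresholdTranslation
import Literature.Computability.Complexity.SymmetricCircuit
import Literature.Computability.Complexity.CircuitSemantics
import Literature.Computability.Complexity.ConstantDepth
import Literature.Computability.Complexity.CircuitDAG
import Literature.Computability.Complexity.CircuitReduce
import Literature.ModelTheory.FiniteModelTheory.SymmetricCircuitCountingWidth

/-!
# SymmetryDial — Q = `AffineThresholdTranslation` PROVED (route `SymmetryDial`, item 23711)

Workshop `decomp-valiant`, lens 1, gen 5.  `Theorems/SymmetryDialAffineCFISplit.lean` split A₂ =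
`SymHardAffineSupported` as `AffineCFIPairs → AffineThresholdTranslation → SymHardAffineSupported`; this
file PROVES the second input (Dawar–Wilsenach 2025, arXiv:2503.15523v2, Thm 5.1, made `AGL_d`-relative
and support-tracing): the Literature construction (`LabelledArithCircuit.tdag`, `GateDAG.reduce`,
`GateDAG.compile`) on the renumbered circuit `toFin C`, pulled back along `𝔽₂^d ≃ Fin N` (`mapIn`,
re-proved after `HeldKarpInducedSubgraph.lean`), plus the SUPPORT BOOKKEEPING: `tperm ρ τ` fixes every
threshold gate over a gate `g` with `τ g = g`, every `¬x_{uv}` with `ρ u = u, ρ v = v` (the `+2`),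
constants and output; this persists through `reduce` (`θR`: a class / padding chain inherits the
stabiliser of its representative / wire) and `compile` (`posC`).  The theorem is stated with the
definitions of the split file unfolded (that file imports the route file, so it cannot be imported
here); its rev 3 reads the theorem back by name.  LADDER-Valiant rung 0: nothing here bears on VP ≠ VNP
beyond closing the translation half of the A₂ split.
-/

set_option linter.dupNamespace false

open scoped Classical

namespace Summit.ValiantsHypothesis.ValiantsHypothesis.Theorems.SymmetryDialAffineThreshold

open Literature.Computability.AlgebraicComplexity
open Literature.Computability.Complexity

/-! ### Vocabulary (verbatim carriers; `Theorems.SymmetryDialAffineCFISplit` is not importable here) -/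

/-- The index set `𝔽₂^d`. -/
abbrev V (d : ℕ) : Type := Fin d → Fin 2

/-- `AGL_d(𝔽₂)` as in the route file. -/
abbrev AGL (d : ℕ) : Subgroup (Equiv.Perm (V d)) :=
  Subgroup.closure {σ : Equiv.Perm (Fin d → Fin 2) | ∀ x y z : Fin d → Fin 2, σ (x + y + z) = σ x + σ y + σ z}

/-- The diagonal action on matrix positions. -/
def diag {d : ℕ} (σ : Equiv.Perm (V d)) : V d × V d → V d × V d := fun q => (σ q.1, σ q.2)

/-- The action of `AGL_d` on positions is the diagonal one. -/
theorem agl_smul_pair {d : ℕ} (σ : ↥(AGL d)) (x : V d × V d) : σ • x = (σ.1 x.1, σ.1 x.2) := rfl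

/-- The action of `Sym(Fin m)` on positions is the diagonal one. -/
theorem perm_smul_pair {m : ℕ} (ρ : Equiv.Perm (Fin m)) (x : Fin m × Fin m) : ρ • x = (ρ x.1, ρ x.2) := rfl


/-! ### Part 0 — renaming the inputs of a DAG circuit (after `HeldKarpInducedSubgraph.lean`) -/

section MapIn

variable {ι κ Λ : Type*}

/-- **Renaming the inputs of a DAG circuit** along `e : ι → κ`: same gates, same gate functions,
input wire `i` becomes `e i`. -/
def mapIn (e : ι → κ) (D : GateDAG ι Λ) : GateDAG κ Λ where
  fn := D.fn
  args l a := (D.args l a).map e id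
  out := D.out.map e id
  wf := by
    have key : ∀ (w : ι ⊕ Λ) (m : Λ), w.map e id = Sum.inr m ↔ w = Sum.inr m := fun w m => by
      cases w <;> simp
    have h : (fun m l => ∃ a, (D.args l a).map e id = Sum.inr m) = fun m l => ∃ a, D.args l a = Sum.inr m := by
      funext m l; simp only [key]
    rw [h]; exact D.wf

/-- Gate functions are unchanged. -/
@[simp] theorem mapIn_fn (e : ι → κ) (D : GateDAG ι Λ) (l : Λ) : (mapIn e D).fn l = D.fn l := rfl

/-- **Semantics of renaming**: gate `l` of `mapIn e D` on input `u` has the value of gate `l` of `D`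
on `u ∘ e`. -/
theorem val_mapIn (e : ι → κ) (D : GateDAG ι Λ) (u : κ → Bool) (l : Λ) :
    (mapIn e D).val u l = D.val (u ∘ e) l := by
  induction l using D.wf.induction with
  | _ l ih =>
    rw [GateDAG.val_eq, GateDAG.val_eq]
    show (D.fn l).2 _ = (D.fn l).2 _
    refine congrArg (D.fn l).2 (funext fun a => ?_)
    show GateDAG.wire u ((mapIn e D).val u) ((D.args l a).map e id) =
      GateDAG.wire (u ∘ e) (D.val (u ∘ e)) (D.args l a)
    cases h : D.args l a with
    | inl i => rfl
    | inr m =>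
      simp only [Sum.map_inr, id_eq, GateDAG.wire_inr]
      exact ih m ⟨a, h⟩

/-- The output of the renamed DAG. -/
theorem evalOut_mapIn (e : ι → κ) (D : GateDAG ι Λ) (u : κ → Bool) :
    (mapIn e D).evalOut u = D.evalOut (u ∘ e) := by
  show GateDAG.wire u ((mapIn e D).val u) (D.out.map e id) = GateDAG.wire (u ∘ e) (D.val (u ∘ e)) D.out
  rcases hD : D.out with i | m
  · rfl
  · simp only [Sum.map_inr, id_eq, GateDAG.wire_inr]; exact val_mapIn e D u m

/-- **Automorphisms transport along an intertwining renaming**: if `π' (e i) = e (π i)` for all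
`i`, an automorphism `θ` of `D` over `π` is an automorphism of `mapIn e D` over `π'`. -/
theorem isAut_mapIn {D : GateDAG ι Λ} {π : ι → ι} {θ : Λ ≃ Λ} (h : D.IsAut π θ) (e : ι → κ)
    {π' : κ → κ} (hcomm : ∀ i, π' (e i) = e (π i)) : (mapIn e D).IsAut π' θ := by
  have key : ∀ w : ι ⊕ Λ, Sum.map π' θ (w.map e id) = (Sum.map π θ w).map e id := by
    intro w; cases w <;> simp [hcomm]
  refine ⟨?_, h.fn_eq, fun l => ?_⟩
  · show Sum.map π' θ (D.out.map e id) = D.out.map e id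
    rw [key, h.out_eq]
  · show (List.ofFn fun a => (D.args (θ l) a).map e id).Perm
      ((List.ofFn fun a => (D.args l a).map e id).map (Sum.map π' θ))
    have e1 : (List.ofFn fun a => (D.args (θ l) a).map e id) =
        (List.ofFn (D.args (θ l))).map (fun w => w.map e id) := by
      rw [List.map_ofFn]; rfl
    have e2 : (List.ofFn fun a => (D.args l a).map e id).map (Sum.map π' θ) =
        ((List.ofFn (D.args l)).map (Sum.map π θ)).map (fun w => w.map e id) := by
      rw [List.map_ofFn, List.map_ofFn, List.map_ofFn]
      congr 1; funext a; exact key _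
    rw [e1, e2]
    exact (h.args_perm l).map _

end MapIn

/-! ### Part A — support bookkeeping for the Literature threshold translation (inputs `Fin m × Fin m`) -/

section FinLevel

variable {m : ℕ} {G : Type} [Fintype G] (Φ : LabelledArithCircuit ℂ (Fin m × Fin m) Unit G) (S : Set ℂ)

/-- The automorphism of the threshold DAG, over the diagonal PERMUTATION `ρ × ρ`. -/
theorem isAut_tdag_prod {ρ : Equiv.Perm (Fin m)} {τ : Equiv.Perm G} (hτ : Φ.IsAutomorphismExtending ρ τ) :
    (Φ.tdag S).IsAut (⇑(Equiv.prodCongr ρ ρ)) (Φ.tperm ρ τ) := by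
  rw [LabelledArithCircuit.coe_prodCongr_eq_diagAct]
  exact Φ.isAut_tdag S hτ

/-- What a threshold gate is built over: a gate of `Φ`, an input position, or nothing. -/
def tbase : Φ.TGate → Option (G ⊕ (Fin m × Fin m))
  | .one => none | .zero => none | .out => none
  | .notx x => some (.inr x)
  | .thr g _ _ => some (.inl g) | .neg g _ _ => some (.inl g) | .exa g _ _ => some (.inl g)
  | .prof g _ => some (.inl g) | .ind g _ => some (.inl g)

/-- The condition under which `tperm ρ τ` fixes a gate built over the given base. -/
def Fixes (ρ : Equiv.Perm (Fin m)) (τ : Equiv.Perm G) : Option (G ⊕ (Fin m × Fin m)) → Prop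
  | none => True
  | some (.inl g) => τ g = g
  | some (.inr x) => ρ x.1 = x.1 ∧ ρ x.2 = x.2

/-- `tperm ρ τ` fixes every threshold gate whose base it fixes. -/
theorem tperm_eq_self {ρ : Equiv.Perm (Fin m)} {τ : Equiv.Perm G} (l : Φ.TGate)
    (h : Fixes ρ τ (tbase Φ l)) : Φ.tperm ρ τ l = l := by
  cases l <;> simp_all [tbase, Fixes, LabelledArithCircuit.tmap, perm_smul_pair]

/-- What a reduced gate is built over: a class is built over the base of its chosen representative,
a padding chain over an input wire over that input, a chain over a class wire over that class. -/
noncomputable def rbase : (Φ.tdag S).RGate → Option (G ⊕ (Fin m × Fin m))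
  | .inl q => tbase Φ q.out.1
  | .inr ⟨.inl x, _⟩ => some (.inr x)
  | .inr ⟨.inr q, _⟩ => tbase Φ q.out.1

variable {Φ S}

/-- A class is fixed by `θQ` as soon as its representative is fixed. -/
theorem θQ_eq_self {ρ : Equiv.Perm (Fin m)} {τ : Equiv.Perm G}
    (hA : (Φ.tdag S).IsAut (⇑(Equiv.prodCongr ρ ρ)) (Φ.tperm ρ τ)) (q : (Φ.tdag S).CQ)
    (h : Fixes ρ τ (tbase Φ q.out.1)) : hA.θQ q = q := by
  have hfix : Φ.tperm ρ τ q.out.1 = q.out.1 := tperm_eq_self Φ _ h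
  have hN : hA.θN q.out = q.out := Subtype.ext hfix
  have hq : (Φ.tdag S).cls q.out = q := Quotient.out_eq q
  conv_lhs => rw [← hq]
  rw [hA.θQ_cls, hN, hq]

/-- A reduced gate is fixed by `θR` as soon as its base is fixed. -/
theorem θR_eq_self {ρ : Equiv.Perm (Fin m)} {τ : Equiv.Perm G}
    (hA : (Φ.tdag S).IsAut (⇑(Equiv.prodCongr ρ ρ)) (Φ.tperm ρ τ)) (r : (Φ.tdag S).RGate)
    (h : Fixes ρ τ (rbase Φ S r)) : hA.θR r = r := by
  rcases r with q | ⟨w, k, hk⟩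
  · rw [hA.θR_inl, θQ_eq_self hA q h]
  · have hw : hA.mapW w = w := by
      rcases w with x | q
      · obtain ⟨x1, x2⟩ := x
        have h' : ρ x1 = x1 ∧ ρ x2 = x2 := h
        simp [GateDAG.IsAut.mapW_eq, h'.1, h'.2]
      · have h' : Fixes ρ τ (tbase Φ q.out.1) := h
        rw [GateDAG.IsAut.mapW_eq, Sum.map_inr, θQ_eq_self hA q h']
    have h1 := hA.map_chainWire w (k : ℕ)
    rw [hw, (Φ.tdag S).chainWire_of_lt hk k.2] at h1
    simpa using h1

end FinLevel

/-! ### Part B — numbering `𝔽₂^d` and transporting the arithmetic circuit -/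

section Transport

variable {d : ℕ}

/-- `N = 2^d`, as the cardinality of `𝔽₂^d`. -/
abbrev N (d : ℕ) : ℕ := Fintype.card (V d)

/-- A numbering of `𝔽₂^d`. -/
noncomputable def enum (d : ℕ) : V d ≃ Fin (N d) := Fintype.equivFin (V d)

/-- The induced numbering of matrix positions. -/
noncomputable def enum2 (d : ℕ) : V d × V d ≃ Fin (N d) × Fin (N d) := (enum d).prodCongr (enum d)

/-- `enum2` is `enum` on both coordinates. -/
theorem enum2_apply (x : V d × V d) : enum2 d x = (enum d x.1, enum d x.2) := rfl

/-- `enum2.symm` is `enum.symm` on both coordinates. -/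
theorem enum2_symm_apply (i : Fin (N d) × Fin (N d)) :
    (enum2 d).symm i = ((enum d).symm i.1, (enum d).symm i.2) := rfl

/-- A permutation of `𝔽₂^d`, read through the numbering. -/
noncomputable def conj (σ : Equiv.Perm (V d)) : Equiv.Perm (Fin (N d)) :=
  ((enum d).symm.trans σ).trans (enum d)

/-- `conj σ` intertwines `enum`. -/
theorem conj_enum (σ : Equiv.Perm (V d)) (v : V d) : conj σ (enum d v) = enum d (σ v) := by
  simp [conj]

/-- `conj σ` explicitly. -/
theorem conj_apply (σ : Equiv.Perm (V d)) (i : Fin (N d)) : conj σ i = enum d (σ ((enum d).symm i)) := rfl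

/-- Relabelling the variables of a gate label along `enum2`. -/
noncomputable def relab : CircuitLabel ℂ (V d × V d) → CircuitLabel ℂ (Fin (N d) × Fin (N d))
  | .var x => .var (enum2 d x) | .const c => .const c | .add => .add | .mul => .mul

/-- `relab` preserves being an input label. -/
theorem isInput_relab (l : CircuitLabel ℂ (V d × V d)) : (relab l).IsInput ↔ l.IsInput := by
  cases l <;> simp [relab, CircuitLabel.IsInput]

/-- `relab` is injective. -/
theorem relab_injective : Function.Injective (relab (d := d)) := by
  intro l l' h
  cases l <;> cases l' <;> simp_all [relab]

variable {G : Type} (C : LabelledArithCircuit ℂ (V d × V d) Unit G)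

/-- The arithmetic circuit with its variables renumbered: same gates, same wires. -/
noncomputable def toFin : LabelledArithCircuit ℂ (Fin (N d) × Fin (N d)) Unit G where
  children := C.children
  label g := relab (C.label g)
  output := C.output
  wf := C.wf
  isInput_iff g := (isInput_relab (C.label g)).trans (C.isInput_iff g)
  eq_of_label_eq g g' hin heq :=
    C.eq_of_label_eq g g' ((isInput_relab (C.label g)).1 hin) (relab_injective heq)
  output_injective := C.output_injective

/-- The renumbered circuit computes the renamed polynomials. -/
theorem toFin_eval (g : G) : (toFin C).eval g = MvPolynomial.rename (enum2 d) (C.eval g) := by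
  refine @WellFounded.induction _ _ C.wf
    (fun g => (toFin C).eval g = MvPolynomial.rename (enum2 d) (C.eval g)) g (fun g ih => ?_)
  rcases hlab : C.label g with x | c | _ | _
  · have h' : (toFin C).label g = .var (enum2 d x) := by show relab (C.label g) = _; rw [hlab]; rfl
    rw [(toFin C).eval_of_label_var h', C.eval_of_label_var hlab, MvPolynomial.rename_X]
  · have h' : (toFin C).label g = .const c := by show relab (C.label g) = _; rw [hlab]; rfl
    rw [(toFin C).eval_of_label_const h', C.eval_of_label_const hlab, MvPolynomial.rename_C]
  · have h' : (toFin C).label g = .add := by show relab (C.label g) = _; rw [hlab]; rfl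
    rw [(toFin C).eval_of_label_add h', C.eval_of_label_add hlab, map_sum]
    exact Finset.sum_congr rfl fun h hh => ih h hh
  · have h' : (toFin C).label g = .mul := by show relab (C.label g) = _; rw [hlab]; rfl
    rw [(toFin C).eval_of_label_mul h', C.eval_of_label_mul hlab, map_prod]
    exact Finset.prod_congr rfl fun h hh => ih h hh

/-- `0/1` values of the renumbered circuit are `0/1` values of `C` at the renumbered matrix. -/
theorem toFin_bval [Fintype G] (A : Fin (N d) × Fin (N d) → Bool) (g : G) :
    (toFin C).bval A g =
      MvPolynomial.eval (fun ij => if A (enum2 d ij) = true then (1 : ℂ) else 0) (C.eval g) := by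
  unfold LabelledArithCircuit.bval
  rw [toFin_eval, MvPolynomial.eval_rename]
  rfl

/-- An automorphism of `C` extending `σ ∈ AGL_d` is an automorphism of the renumbered circuit
extending `conj σ`. -/
theorem toFin_isAut {σ : ↥(AGL d)} {π : Equiv.Perm G} (h : C.IsAutomorphismExtending σ π) :
    (toFin C).IsAutomorphismExtending (conj σ.1) π where
  children_apply := h.children_apply
  label_apply g := by
    show relab (C.label (π g)) = conj σ.1 • relab (C.label g)
    rw [h.label_apply]
    rcases C.label g with x | c | _ | _
    · show CircuitLabel.var (enum2 d (σ • x)) = CircuitLabel.var (conj σ.1 • enum2 d x)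
      rw [agl_smul_pair, enum2_apply, enum2_apply, perm_smul_pair, conj_enum, conj_enum]
    all_goals rfl
  output_smul y := h.output_smul y

/-- The diagonal actions are intertwined by `enum2.symm`. -/
theorem diag_comm (σ : Equiv.Perm (V d)) (i : Fin (N d) × Fin (N d)) :
    diag σ ((enum2 d).symm i) = (enum2 d).symm (Equiv.prodCongr (conj σ) (conj σ) i) := by
  obtain ⟨i1, i2⟩ := i
  simp [diag, enum2_symm_apply, conj_apply]

end Transport

/-! ### Part C — the theorem -/

/-- **Q = `AffineThresholdTranslation` (Dawar–Wilsenach Thm 5.1, `AGL_d`-relative, support-tracing).**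
Stated with `ArithSupported`, `Admissible`, `BoolSymmetric`, `BoolSupported`, `boolEval`, `diag` of
`Theorems.SymmetryDialAffineCFISplit` unfolded, so that it is literally that file's
`AffineThresholdTranslation`. -/
theorem affineThresholdTranslation :
    ∀ (k d : ℕ) (G : Type) [Fintype G]
      (C : LabelledArithCircuit ℂ (V d × V d) Unit G),
      C.IsSymmetric ↥(AGL d) →
      (∀ g : G, ∃ (U : Finset (V d)) (W : AddSubgroup (V d)), U.card ≤ k ∧ W.index ≤ 2 ^ k ∧
          ∀ σ : ↥(AGL d), (∀ u ∈ U, σ.1 u = u) → (∀ v : V d, σ.1 v + v ∈ W) →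
            ∃ π : Equiv.Perm G, C.IsAutomorphismExtending σ π ∧ π g = g) →
      ∀ S : Set ℂ, ∃ Ψ : Circuit (V d × V d),
        (Ψ.IsOver tcBasis ∧ Ψ.HasSimpleWiring ∧
          (∀ σ : ↥(AGL d), ∃ τ : Equiv.Perm (Fin Ψ.gates.length),
              Ψ.IsInducedAut (fun q : V d × V d => (σ.1 q.1, σ.1 q.2)) τ) ∧
          ∀ j : Fin Ψ.gates.length, ∃ (U : Finset (V d)) (W : AddSubgroup (V d)),
            U.card ≤ k + 2 ∧ W.index ≤ 2 ^ (k + 2) ∧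
            ∀ σ : ↥(AGL d), (∀ u ∈ U, σ.1 u = u) → (∀ v : V d, σ.1 v + v ∈ W) →
              ∃ τ : Equiv.Perm (Fin Ψ.gates.length),
                Ψ.IsInducedAut (fun q : V d × V d => (σ.1 q.1, σ.1 q.2)) τ ∧ τ j = j) ∧
        ∀ A : V d × V d → Bool, Ψ.eval A = true ↔
          MvPolynomial.eval (fun ij => if A ij = true then (1 : ℂ) else 0) (C.eval (C.output ())) ∈ S := by
  intro k d G _ C hsym hsupp S
  -- the Literature construction on the renumbered circuit, pulled back to `𝔽₂^d × 𝔽₂^d`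
  let Φ := toFin C
  let E := mapIn (enum2 d).symm (Φ.tdag S).reduce
  -- the induced automorphism of `E.compile` coming from an automorphism `π` of `C` over `σ`
  have aut : ∀ (σ : ↥(AGL d)) (π : Equiv.Perm G) (hπ : C.IsAutomorphismExtending σ π),
      ∃ hA : (Φ.tdag S).IsAut (⇑(Equiv.prodCongr (conj σ.1) (conj σ.1))) (Φ.tperm (conj σ.1) π),
        E.compile.IsInducedAut (fun q : V d × V d => (σ.1 q.1, σ.1 q.2))
          (E.posC.symm.trans (hA.θR.trans E.posC)) := by
    intro σ π hπ
    have hA := isAut_tdag_prod Φ S (toFin_isAut C hπ)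
    refine ⟨hA, ?_⟩
    have hE : E.IsAut (diag σ.1) hA.θR :=
      isAut_mapIn hA.reduce (enum2 d).symm (π' := diag σ.1) (fun i => diag_comm σ.1 i)
    exact hE.isInducedAut_compile
  refine ⟨E.compile, ⟨?_, ?_, ?_, ?_⟩, ?_⟩
  · -- basis
    exact E.compile_isOver fun l => (Φ.tdag S).reduce_fn_mem (Φ.tfn_mem_tcBasis S) and_one_mem_tcBasis l
  · -- simple wiring
    refine E.compile_hasSimpleWiring fun l => ?_
    exact (Sum.map_injective.2 ⟨(enum2 d).symm.injective, Function.injective_id⟩).comp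
      ((Φ.tdag S).reduce_args_injective l)
  · -- symmetry
    intro σ
    obtain ⟨π, hπ⟩ := hsym σ
    obtain ⟨hA, hind⟩ := aut σ π hπ
    exact ⟨_, hind⟩
  · -- supports
    intro j
    -- a flag-let whose fixator fixes the base of the reduced gate at position `j`
    have key : ∀ (U : Finset (V d)) (W : AddSubgroup (V d)),
        (∀ σ : ↥(AGL d), (∀ u ∈ U, σ.1 u = u) → (∀ v : V d, σ.1 v + v ∈ W) →
          ∃ π : Equiv.Perm G, C.IsAutomorphismExtending σ π ∧
            Fixes (conj σ.1) π (rbase Φ S (E.posC.symm j))) →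
        ∀ σ : ↥(AGL d), (∀ u ∈ U, σ.1 u = u) → (∀ v : V d, σ.1 v + v ∈ W) →
          ∃ τ : Equiv.Perm (Fin E.compile.gates.length),
            E.compile.IsInducedAut (fun q : V d × V d => (σ.1 q.1, σ.1 q.2)) τ ∧ τ j = j := by
      intro U W hUW σ hU hW
      obtain ⟨π, hπ, hfx⟩ := hUW σ hU hW
      obtain ⟨hA, hind⟩ := aut σ π hπ
      refine ⟨_, hind, ?_⟩
      have hr : hA.θR (E.posC.symm j) = E.posC.symm j := θR_eq_self hA _ hfx
      simp [Equiv.trans_apply, hr]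
    rcases hb : rbase Φ S (E.posC.symm j) with _ | ⟨g | x⟩
    · -- constants / output: fixed by every induced automorphism
      refine ⟨∅, ⊤, by simp, by simp [Nat.one_le_two_pow], key ∅ ⊤ fun σ _ _ => ?_⟩
      obtain ⟨π, hπ⟩ := hsym σ
      exact ⟨π, hπ, by rw [hb]; trivial⟩
    · -- built over the gate `g` of `C`: inherit its flag-let
      obtain ⟨U, W, hU, hW, hfix⟩ := hsupp g
      refine ⟨U, W, hU.trans (Nat.le_add_right k 2),
        hW.trans (Nat.pow_le_pow_right (by norm_num) (Nat.le_add_right k 2)), key U W fun σ hσU hσW => ?_⟩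
      obtain ⟨π, hπ, hπg⟩ := hfix σ hσU hσW
      exact ⟨π, hπ, by rw [hb]; exact hπg⟩
    · -- a negated input `¬ x_{uv}`: the flag-let `({u, v}, ⊤)` — the `+2`
      refine ⟨{(enum d).symm x.1, (enum d).symm x.2}, ⊤, Finset.card_le_two.trans (Nat.le_add_left 2 k),
        by simp [Nat.one_le_two_pow], key _ ⊤ fun σ hσU _ => ?_⟩
      obtain ⟨π, hπ⟩ := hsym σ
      refine ⟨π, hπ, ?_⟩
      rw [hb]
      have h1 : σ.1 ((enum d).symm x.1) = (enum d).symm x.1 := hσU _ (by simp)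
      have h2 : σ.1 ((enum d).symm x.2) = (enum d).symm x.2 := hσU _ (by simp)
      exact ⟨by rw [conj_apply, h1, Equiv.apply_symm_apply], by rw [conj_apply, h2, Equiv.apply_symm_apply]⟩
  · -- semantics
    intro A
    rw [GateDAG.compile_eval, evalOut_mapIn,
      GateDAG.evalOut_reduce _ (Φ.tfn_isSymmetric S), Φ.evalOut_tdag S, decide_eq_true_iff,
      toFin_bval]
    simp only [Function.comp_apply, Equiv.symm_apply_apply]
    exact Iff.rfl

end Summit.ValiantsHypothesis.ValiantsHypothesis.Theorems.SymmetryDialAffineThreshold
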